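import Mathlib
import HarnessLib
import HarnessLib.Audit
import Summits.NavierStokesRegularity.Statement
import Literature.Analysis.FluidPDE.ClassicalSolution
import Literature.Analysis.FluidPDE.LerayHopf
import Literature.Analysis.FluidPDE.NSWave0
import Literature.Analysis.FluidPDE.LocalTypeI
import Literature.Analysis.FluidPDE.VectorCalculus
import Literature.Analysis.FluidPDE.Vorticity
import Literature.Analysis.FluidPDE.NSBoundedMildOseen
import Literature.Analysis.UnboundedOperators.HeatKernel
import Literature.Analysis.FluidPDE.SuitableWeak
import Literature.Analysis.FluidPDE.WeakSolution
import Summits.NavierStokesRegularity.NavierStokesRegularity.Theses.HalfSpaceWindowDoor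
import HarnessLib.Audit.Status.Attr

/-!
Route: FilamentPinchDoor

# Route FilamentPinchDoor — Energy-class half-space door — a one-signed Type-I profile is a
filament, and filaments cannot pinch

It suffices to show X = the HALF-SPACE WINDOW DOOR leaf `HalfSpaceWindowDoor.Target` (rung
N0-LocalTubeDoorHalfSpace, label LocalTubeDoorHalfSpace; an EXISTING leaf, not Clay): a classical
Leray–Hopf solution, locally Type I at (x₀,T), whose scale-normalised vorticity component
⟪(T−t)·curl u, e⟫ has L²-fading negative part on every similarity window, is backward bounded at
(x₀,T). This LINE re-decides that leaf through a different profile class and a different rigidity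
mechanism than the host route: the zoom is run in the Albritton–Barker ENERGY class (suitable on the
backward slab, scale-invariant bound 𝐈 < ∞), in which a one-signed vorticity component is forced to
be FILAMENTARY (its mass in every ball B_R grows at most linearly in R, uniformly in time), and the
research content becomes: a singular one-signed Type-I filament with laterally frozen circulation is
poloidal (then the shared crux PoloidalWindowRigidity, stmt-19708, finishes). No summit (Clay A–D)
is proved by this line; it bears on rung N0-LocalTubeDoorHalfSpace only.
Lean: `Summit.NavierStokesRegularity.NavierStokesRegularity.Theses.HalfSpaceWindowDoor.Target`

## Assembly
Pure logic (kernel-checked in Sketch.lean / glue.lean, no sorry): by contradiction,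
SuitableHalfSpaceZoom gives the energy-class one-signed profile, FilamentaryGrowth its growth
constant K, FilamentPinchLiouville makes ⟪curl v, e⟫ ≡ 0, and PoloidalWindowRigidity (applied with U
= univ on every slice) says such a profile is not backward singular — contradiction. The deciding
theorem is `closes (hZ : SuitableHalfSpaceZoom) (hF : FilamentaryGrowth) (hP :
FilamentPinchLiouville) (hW : PoloidalWindowRigidity) : HalfSpaceWindowDoor.Target`; the Assembly
item below records the same chain BY NAME (closed by `fun hZ hF hP hW => closes hZ hF hP hW`).

CLOSES_TARGET: closes rung N0-LocalTubeDoorHalfSpace (DOOR) of NavierStokesRegularity: Summit.NavierStokesRegularity.NavierStokesRegularity.Theses.HalfSpaceWindowDoor.Target (D-0061; not the summit Statement) — the deciding theorem of this route concludes that registered leaf instead of the Statement decl `NavierStokesRegularity` (class rung: servable and labelled, never counted as concluding the summit Statement).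

Rationale: WHY THIS LINE. Assume the opposite and build the singularity: the blow-up profile at a
non-backward-bounded locally Type-I point inherits not only the Type-I time rate and Oseen-mildness
(the host's class) but — by Albritton–Barker's weak-Serrin lemma (arXiv:1811.00502 Lemma 2.5/Remark
3.2, tree `exists_typeIBound_le_of_rate`) and their compactness (tree
`LocalTypeIBlowup.Engine.local_typeI_compactness`,
`RellichScarTypeIBlowupProfileZoomLimit.slab_typeIBound_of_zoomLimit`) — suitability on the backward
slab with 𝐈 < ∞, i.e. the scaled energy of EVERY slice on EVERY ball is ≤ 2𝐈r (tree
`LocalTypeISliceMorrey.ae_forall_lintegral_ball_le_of_typeIBound_apex`). For a ONE-SIGNED component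
ω_e ≥ 0 this is decisive kinematics: testing ω_e against a cutoff and integrating the curl by parts
(tree `integral_inner_curl_eq_integral_inner_curl`) gives ∫_(B_R) ω_e ≤ (c/R)·∫_(B_2R)|v| ≤ c'√𝐈·R —
the putative counterexample carries its signed vorticity on a set of 1-dimensional growth (a
Frostman-1 measure, uniformly in t<0): vortex LAYERS and volumes are excluded outright (the host
route's XL stub `stub_layerExclusion` becomes a corollary), and what is left is a Type-I vortex
FILAMENT whose windowed circulation at scales L ≫ √(−t) is frozen in time (windowed Kelvin law with
errors O(√(−s)/L), using the slice-enstrophy Morrey bound). The research crux is then the exclusion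
of the pinching Type-I filament with quantised circulation — the Burgers-vortex caricature under
Type-I decay (its axisymmetric case is Koch–Nadirashvili–Seregin–Šverák arXiv:0709.3599; the general
one-signed case is the open Remark 1.3 of Lei–Ren–Tian arXiv:2501.08976, here attacked with two
extra theorems-worth of structure). Imported: geometric measure theory language (upper 1-density of
a signed-component measure) and the local-energy (CKN/A–B) theory, pointed at a sign condition; no
listed route combines the energy class with a vorticity SIGN
(IrrotScar/RellichScar/ClockStretchingLaw use 𝐈 with irrotational scars, frequency functions or
clocks; the host HalfSpaceWindowDoor and PoloidalWindowDoor use the sign in the time-rate class,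
where the signed mass is not even locally finite a priori).

RANKED CRUXES. #2 FilamentPinchLiouville (crux) — A Type-I ancient Oseen-mild divergence-free
profile on (−∞,0)×ℝ³ which is ALSO a suitable weak solution on the backward slab with 𝐈 < ∞, whose
vorticity component ⟪curl v, e⟫ (e ≠ 0) is non-negative everywhere and has linear ball growth
(∫_(B_R(x)) ⟪curl v(s), e⟫ ≤ K·R for all s<0, x, R), and which is backward singular at (0,0), has
⟪curl v, e⟫ ≡ 0 (it is poloidal). The research core of the line. [deps: FilamentaryGrowth,
SuitableHalfSpaceZoom] [difficulty: XL] (why it might fail: a non-axisymmetric Type-I self-focusing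
vortex filament with quantised circulation Φ₀>0 (Burgers-vortex caricature with Type-I decay) may
exist — exactly the open one-signed case of Lei–Ren–Tian Rem. 1.3; only its axisymmetric version is
excluded (KNSS).) [arXiv:2501.08976, arXiv:0709.3599, arXiv:1811.00502]
#3 FilamentaryGrowth (crux) — In the same energy class, non-negativity of ⟪curl v, e⟫ alone forces
FILAMENTARY growth: there is K with ∫_(B_R(x)) ⟪curl v(s), e⟫ ≤ K·R for every s<0, centre x and
radius R>0 (K = c·‖e‖·√𝐈: cutoff test function, curl integrated by parts onto the cutoff,
Cauchy–Schwarz, slice Morrey bound ∫_(B_r)|v(s)|² ≤ 2𝐈r). The assume-the-opposite structural lemma: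
the counterexample's signed vorticity lives on a set of 1-dimensional growth, uniformly in time;
layers and volumes are impossible. [difficulty: M] (why it might fail: the slice Morrey bound from 𝐈
is an a.e.-in-time statement (cknAEss); upgrading to every s<0 needs L²_loc-continuity of slices
from the mild class, and K must not degrade as s→0⁻ — a bookkeeping risk, not a mathematical one.)
[arXiv:1811.00502, CaffarelliKohnNirenberg1982]
#4 PoloidalWindowRigidity (crux) — (shared with PoloidalWindowDoor K2' =
stmt-NavierStokesRegularity-19708 and the host route, verbatim) a Type-I ancient Oseen-mild
divergence-free profile has continuous vorticity slices, and if some fixed component of its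
vorticity vanishes on a nonempty open set of every time slice then it is not backward singular at
the apex. Consumed here only in the everywhere-zero case produced by FilamentPinchLiouville.
[difficulty: XL] (why it might fail: a poloidal (ω₃ ≡ 0, v_h = ∇_h φ slice-wise) Type-I ancient mild
profile could still be singular — the 2½-D Liouville problem of PoloidalWindowDoor (STRATEGY-CENSUS
g6: all identity-based levers integrate to boundary terms).) [arXiv:0709.3599, arXiv:2501.08976]
#9 SuitableHalfSpaceZoom (support) — Energy-class half-space zoom: under the leaf's frame
hypotheses, the door hypothesis and ¬ backward bounded at (x₀,T), rescaling about x₀ along λ_j→0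
yields a profile that is Type-I in time, continuous, Oseen-mild and divergence-free (the host's
HalfSpaceZoom, CLOSED as stmt-25312) AND a suitable weak solution on the backward slab with a weak
spatial gradient and 𝐈 < ∞ (weak-Serrin rate lemma for u on Q((T,x₀),ρ) + Albritton–Barker/Seregin
extraction along the same scales, limits identified a.e.), backward singular at (0,0), with ⟪curl
v(s) y, e⟫ ≥ 0 everywhere. [difficulty: M] [arXiv:1811.00502, SereginSverak2009, arXiv:0709.3599]

TWO-LAYER PLAN. FilamentPinchLiouville ⇐ (FrozenFarFieldFlux: for unit 3-D windows of scale L the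
windowed flux of ⟪curl v, e⟫ changes by at most K''(√(−s)/L + (t−s)/L²) between times s<t<0 —
windowed Kelvin law, slice-enstrophy Morrey bound ∫_(B_L)|∇v(s)|² ≲ 𝐈L/(−s), FilamentaryGrowth) →
(PinchExclusion: no backward-singular one-signed filament with frozen far-field flux) →
FilamentPinchLiouville, k = 2, filed only after a prover asks; the birth skeleton carries exactly
these two stubs.

KILL CRITERIA. An explicit Type-I ancient mild suitable profile with ⟪curl v, e⟫ ≥ 0, ≢ 0, singular
at the apex refutes FilamentPinchLiouville and closes the route (refuted:FilamentPinchLiouville) —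
and would be a Type-I blow-up profile candidate of independent interest; the known explicit
one-signed filaments (Burgers vortex: unbounded strain, 𝐈 = ∞; Lamb–Oseen/columnar vortices: not
Type-I ancient; Landau solutions: singular axis for all t, not continuous on the slab) all fail the
class. A refutation of FilamentaryGrowth would have to be a suitable 𝐈-finite field with
super-linear signed mass — impossible by the three-line estimate unless the class is mis-typed (then
restate with the a.e.-in-s quantifier). If stmt-19708 is REFUTED the line pivots to a direct
'filament ⇒ not singular' crux (FilamentPinchLiouville with conclusion ¬ IsBackwardSingularPoint);
if 19708 is PROVED first, this route and the host differ only in the research crux, and whichever of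
CirculationCarryingRigidity / FilamentPinchLiouville closes first moots the other.

NOT DECOMPOSED YET. The windowed Kelvin flux law, the slice-enstrophy Morrey bound (local smoothing
at Type-I regularity, KNSS-type), the quantisation of the far-field circulation Φ₀ and the final
exclusion of Φ₀ > 0 are layer-2 children of FilamentPinchLiouville; the identification of the host's
locally-uniform zoom limit with the Albritton–Barker L³_loc limit (a.e. equality + continuity) is
internal to SuitableHalfSpaceZoom. None is filed now.

CHEAPEST FALSIFIER. The three-line estimate behind FilamentaryGrowth, checked by hand on the
scale-invariant model field v = Φ₀/(2π) · e_θ · f(r/√(−t))/r (columnar filament, core √(−t)):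
∫_(B_R) ω₃ = Φ₀·(filament length in B_R)·(captured fraction) ≤ 2Φ₀R ✓ linear; and on a vortex LAYER
ω₃ = g(x₁/√(−t))/√(−t) (shear layer): ∫_(B_R) ω₃ ~ R² — but its velocity jump makes ∫_(B_r)|v|² ~
r³, violating the slice Morrey bound 2𝐈r, so the layer is outside the energy class, as the lemma
predicts ✓. Second: dimensional consistency of every statement under v ↦ λv(λ²t, λx) (K and 𝐈
invariant) — checked. A refuter's first run: the BC7 tautology probe on FilamentPinchLiouville (its
hypotheses must not be contradictory: the zero field satisfies all but backward singularity) and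
`exact?` against the tree's axisymmetric KNSS facts.

NUMBERS. 𝐈 = sup over parabolic cylinders in the slab of A+C+D+E (Albritton–Barker (1.5)–(1.10));
the zoom gives 𝐈 ≤ 4·𝐈(Q((T,x₀),ρ/2)) (tree `slab_typeIBound_of_zoomLimit`); slice bound
∫_(B(z,r))|v(t)|² ≤ 2r·𝐈 (tree, a.e. t); growth constant K ≤ c·‖e‖·√(2𝐈) with c the cutoff constant
(|∇φ| ≤ 2/R, vol B_2R = 32πR³/3 ⇒ c ≈ 2·(32π/3)^½ ≈ 11.6).

DEFINITION REQUESTS. None: every statement is over existing declarations (`HasTypeITimeDecay`,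
`oseenDuhamel`, `heatExtension`, `IsDivFree`, `curl`, `IsSuitableWeakSolutionOn`, `slab`,
`HasWeakSpatialGradientOn`, `typeIBound`, `IsBackwardSingularPoint`, `IsBackwardBoundedAt`). No mint
needed: the leaf LocalTubeDoorHalfSpace is registered (decl `…Theses.HalfSpaceWindowDoor.Target`).

Novelty: Searches (2026-08-28): rg over the 120+ NS Theses for `typeIBound`/`IsSuitableWeakSolutionOn` (11
routes use the energy class: MeanFieldTypeI, RellichScar, EulerZoomLiouville, MarginalTypeI,
RecurrentProfiles, QuarterBudgetTrace, SqueezeCycle, DulacContraction, LocalIrrotationalScarDoor,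
HardyPointSink, TypeILiouville — none with a vorticity sign; the sign routes
HalfSpaceWindowDoor/PoloidalWindowDoor/CoriolisHead use the time-rate class only); rg for
`Frostman|linear growth|ball x R.*curl` in Theses (0); lit search --hybrid "one-signed vorticity
component ancient solution Navier-Stokes Liouville Type I circulation" (8 docs, textbooks only:
Majda–Bertozzi p.470, LR16 p.770)
[corpus:book:lemarie-rieusset2016-navier-stokes-problem-21st-century p.770]; lit search "Lei Ren
Tian Liouville ancient one sign" --source all (local: arXiv:2501.08976 p.4 Rem 1.3 = the open
one-signed case [corpus:paper:arxiv-2501.08976 p.4]; arXiv:1503.07428 p.3 (2-D half-plane ancient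
solutions with sign-preserving vorticity, Giga–Hsu–Maekawa 2014) [corpus:paper:arxiv-1503.07428
p.3]; crossref: Lei–Ren–Zhang Math. Ann. 2021 axisymmetric Liouville
doi:10.1007/s00208-020-02128-9); lit read arxiv:1811.00502 Remark 3.2 (rate ⇒ 𝐈(Q(1/2)) < ∞ for
suitable solutions — the forward direction used by SuitableHalfSpaceZoom)
[corpus:paper:arxiv-1811.00502 p.7]; lit galaxy search "vortex filament|Burgers vortex|one-signed
vorticity" --star pdf (10 hits, physics/engineering vortex papers, none a Liouville/regularity  [refs: 10.1007/s00208-020-02128-9, 2501.08976, 1503.07428, 1811.00502, book:lemarie-rieusset2016-navier-stokes-problem-21st-century, paper:arxiv-2501.08976, paper:arxiv-1503.07428, doi:10.1007/s00208-020-02128-9, arxiv:1811.00502, paper:arxiv-1811.00502]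

Barriers (technique_class: blow-up-zoom, local-energy, vorticity-sign, liouville): - technique_class: blow-up-zoom, local-energy, vorticity-sign, liouville
- Literature.Barriers.NavierStokesRegularity.AveragedTypeIBlowup: outside its class for the research
crux — FilamentPinchLiouville must use the exact vorticity transport structure (sign preservation is
false for Tao-averaged bilinear forms; the windowed Kelvin law uses div ω = 0 and the conservative
form ∂ₜω₃ = ∂ⱼ(ωⱼv₃ − vⱼω₃) + Δω₃); FilamentaryGrowth itself is pure kinematics + energy and would
survive averaging, which is why it is only rank 3.
- Literature.Barriers.NavierStokesRegularity.EnergySupercriticality: evaded by hypothesis —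
everything is scale-invariant (Type-I door, 𝐈, K dimensionless); the energy enters only through the
critical Morrey quantity A ≤ 𝐈, never through the supercritical global energy.
- Literature.Barriers.NavierStokesRegularity.NavierStokesInequalitySingularSolution: Scheffer-type
singular solutions of the Navier–Stokes INEQUALITY are suitable with finite scaled energies, so no
argument using only the local energy inequality can close FilamentPinchLiouville; the line's closing
step is required to use the equation (Oseen-mild identity and the vorticity equation are hypotheses
of the crux), and the bet is exactly that sign + transport structure, not the inequality, excludes
the filament.
- Literature.Barriers.NavierStokesRegularity.VorticityStrainNonlocality: not beaten head-on; the bet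
is that for a one-signed filament the stretching needed to sustain Type-I concentration is i

sub-problem: NavierStokesRegularity · status: open · opened planner-ns-idea-6-g3-0 2026-08-28T07:04:24Z · rev 0 · ledger route-NavierStokesRegularity-FilamentPinchDoor
GENERATED by the gate from the ledger (D-0016/17). Provers cite these decls: `theorem foo : Summit.NavierStokesRegularity.NavierStokesRegularity.Theses.FilamentPinchDoor.<Decl> := …` in Summits/NavierStokesRegularity/NavierStokesRegularity/Theorems/<Name>.lean.
-/

namespace Summit.NavierStokesRegularity.NavierStokesRegularity.Theses.FilamentPinchDoor

open scoped BigOperators Topology Manifold Classical MeasureTheory ProbabilityTheory Matrix InnerProductSpace ComplexConjugate ContinuousMap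
open Filter Set Function TopologicalSpace MeasureTheory

attribute [summit_statement] _root_.NavierStokesRegularity
attribute [summit_statement] _root_.Summit.NavierStokesRegularity.NavierStokesRegularity.Theses.HalfSpaceWindowDoor.Target

open Literature.NS

/-- item stmt-NavierStokesRegularity-26430 · crux · rank 2 · open · by planner
why it might fail: a non-axisymmetric Type-I self-focusing vortex filament with quantised circulation Φ₀>0 (Burgers-vortex caricature with Type-I decay) may exist — exactly the open one-signed case of Lei–Ren–Tian Rem. 1.3; only its axisymmetric version is excluded (KNSS).
sources: arXiv:2501.08976, arXiv:0709.3599, arXiv:1811.00502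
[crux] A Type-I ancient Oseen-mild divergence-free profile on (−∞,0)×ℝ³ which is ALSO a suitable
weak solution on the backward slab with 𝐈 < ∞, whose vorticity component ⟪curl v, e⟫ (e ≠ 0) is
non-negative everywhere and has linear ball growth (∫_(B_R(x)) ⟪curl v(s), e⟫ ≤ K·R for all s<0, x,
R), and which is backward singular at (0,0), has ⟪curl v, e⟫ ≡ 0 (it is poloidal). The research core
of the line. [deps: FilamentaryGrowth, SuitableHalfSpaceZoom] [difficulty: XL] -/
@[route_item "route-NavierStokesRegularity-FilamentPinchDoor", crux]
def FilamentPinchLiouville : Prop :=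
  ∀ (C : ℝ) (v : ℝ → EuclideanSpace ℝ (Fin 3) → EuclideanSpace ℝ (Fin 3)) (π : ℝ → EuclideanSpace ℝ (Fin 3) → ℝ) (H : ℝ → EuclideanSpace ℝ (Fin 3) → EuclideanSpace ℝ (Fin 3) →L[ℝ] EuclideanSpace ℝ (Fin 3)), Literature.Analysis.FluidPDE.HasTypeITimeDecay C v → ContinuousOn (Function.uncurry v) (Set.Iio (0 : ℝ) ×ˢ Set.univ) → (∀ s t : ℝ, s < t → t < 0 → ∀ x, v t x = Literature.Analysis.UnboundedOperators.heatExtension (v s) (t - s) x - Literature.Analysis.FluidPDE.oseenDuhamel 1 s v v t x) → (∀ t < 0, Literature.Analysis.FluidPDE.VectorCalculus.IsDivFree (v t)) → Literature.Analysis.FluidPDE.IsSuitableWeakSolutionOn (Literature.Analysis.FluidPDE.slab (EuclideanSpace ℝ (Fin 3)) (Set.Iio (0 : ℝ)) isOpen_Iio) 1 0 v π → Literature.Analysis.FluidPDE.HasWeakSpatialGradientOn (Literature.Analysis.FluidPDE.slab (EuclideanSpace ℝ (Fin 3)) (Set.Iio (0 : ℝ)) isOpen_Iio) v H → Literature.Analysis.FluidPDE.typeIBound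 (Set.Iio (0 : ℝ) ×ˢ Set.univ) v π H < ⊤ → ∀ (e : EuclideanSpace ℝ (Fin 3)), e ≠ 0 → (∀ s < 0, ∀ y, 0 ≤ ⟪Literature.Analysis.FluidPDE.curl (v s) y, e⟫_ℝ) → (∃ K : ℝ, ∀ s < 0, ∀ (x : EuclideanSpace ℝ (Fin 3)) (R : ℝ), 0 < R → ∫⁻ y in Metric.ball x R, ENNReal.ofReal ⟪Literature.Analysis.FluidPDE.curl (v s) y, e⟫_ℝ ≤ ENNReal.ofReal (K * R)) → Literature.Analysis.FluidPDE.IsBackwardSingularPoint v 0 → ∀ s < 0, ∀ y, ⟪Literature.Analysis.FluidPDE.curl (v s) y, e⟫_ℝ = 0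

/-- item stmt-NavierStokesRegularity-26431 · crux · rank 3 · closed · proved by Summit.NavierStokesRegularity.NavierStokesRegularity.Theorems.axisTwistDoor_filamentaryGrowth_proof (prover) · by planner
why it might fail: the slice Morrey bound from 𝐈 is an a.e.-in-time statement (cknAEss); upgrading to every s<0 needs L²_loc-continuity of slices from the mild class, and K must not degrade as s→0⁻ — a bookkeeping risk, not a mathematical one.
sources: arXiv:1811.00502, CaffarelliKohnNirenberg1982
[crux] In the same energy class, non-negativity of ⟪curl v, e⟫ alone forces FILAMENTARY growth:
there is K with ∫_(B_R(x)) ⟪curl v(s), e⟫ ≤ K·R for every s<0, centre x and radius R>0 (K =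
c·‖e‖·√𝐈: cutoff test function, curl integrated by parts onto the cutoff, Cauchy–Schwarz, slice
Morrey bound ∫_(B_r)|v(s)|² ≤ 2𝐈r). The assume-the-opposite structural lemma: the counterexample's
signed vorticity lives on a set of 1-dimensional growth, uniformly in time; layers and volumes are
impossible. [difficulty: M] -/
@[route_item "route-NavierStokesRegularity-FilamentPinchDoor", crux]
def FilamentaryGrowth : Prop :=
  ∀ (C : ℝ) (v : ℝ → EuclideanSpace ℝ (Fin 3) → EuclideanSpace ℝ (Fin 3)) (π : ℝ → EuclideanSpace ℝ (Fin 3) → ℝ) (H : ℝ → EuclideanSpace ℝ (Fin 3) → EuclideanSpace ℝ (Fin 3) →L[ℝ] EuclideanSpace ℝ (Fin 3)), Literature.Analysis.FluidPDE.HasTypeITimeDecay C v → ContinuousOn (Function.uncurry v) (Set.Iio (0 : ℝ) ×ˢ Set.univ) → (∀ s t : ℝ, s < t → t < 0 → ∀ x, v t x = Literature.Analysis.UnboundedOperators.heatExtension (v s) (t - s) x - Literature.Analysis.FluidPDE.oseenDuhamel 1 s v v t x) → (∀ t < 0, Literature.Analysis.FluidPDE.VectorCalculus.IsDivFree (v t))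 → Literature.Analysis.FluidPDE.IsSuitableWeakSolutionOn (Literature.Analysis.FluidPDE.slab (EuclideanSpace ℝ (Fin 3)) (Set.Iio (0 : ℝ)) isOpen_Iio) 1 0 v π → Literature.Analysis.FluidPDE.HasWeakSpatialGradientOn (Literature.Analysis.FluidPDE.slab (EuclideanSpace ℝ (Fin 3)) (Set.Iio (0 : ℝ)) isOpen_Iio) v H → Literature.Analysis.FluidPDE.typeIBound (Set.Iio (0 : ℝ) ×ˢ Set.univ) v π H < ⊤ → ∀ (e : EuclideanSpace ℝ (Fin 3)), e ≠ 0 → (∀ s < 0, ∀ y, 0 ≤ ⟪Literature.Analysis.FluidPDE.curl (v s) y, e⟫_ℝ) → ∃ K : ℝ, ∀ s < 0, ∀ (x : EuclideanSpace ℝ (Fin 3)) (R : ℝ), 0 < R → ∫⁻ y in Metric.ball x R, ENNReal.ofReal ⟪Literature.Analysis.FluidPDE.curl (v s) y, e⟫_ℝ ≤ ENNReal.ofReal (K * R)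

-- `FilamentaryGrowth` holds: proved by `Summit.NavierStokesRegularity.NavierStokesRegularity.Theorems.axisTwistDoor_filamentaryGrowth_proof` (its module imports this route file, so no `_holds` link can be stated here).

/-- item stmt-NavierStokesRegularity-19708 · crux · rank 4 · open · by operator
why it might fail: a poloidal (ω₃ ≡ 0, v_h = ∇_h φ slice-wise) Type-I ancient mild profile could still be singular — the 2½-D Liouville problem of PoloidalWindowDoor (STRATEGY-CENSUS g6: all identity-based levers integrate to boundary terms).
sources: arXiv:0709.3599, arXiv:2501.08976
[crux] RIGIDITY OF POLOIDAL TYPE-I PROFILES ON A WINDOW. If v : (−∞,0) × ℝ³ → ℝ³ has the Type-I time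
rate ‖v(t,x)‖ ≤ C/√(−t), is continuous, unit-viscosity Oseen-mild between negative times and
divergence-free, then (a) every vorticity slice curl v(s,·), s < 0, is continuous, and (b) for every
e ≠ 0: if every slice s < 0 carries a nonempty open set on which ⟪curl v(s,y), e⟫ = 0, then v is not
backward-singular at the apex (0,0). KERNEL (cell Sketch7A/Sketch8, 0 sorry): (a) and the
propagation window ⇒ everywhere hold, `poloidalWindowRigidity_iff : K2 ↔ PoloidalProfileRigidity`
(:= no backward-singular profile of the class is poloidal along a fixed e, i.e. ⟪curl v(s), e⟫ ≡ 0);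
settled sub-strata: aligned, two directions, axisymmetric about an axis ∥ e (⇒ swirl-free; KNSS Thm
5.2), self-similar (Tsai), flat (∂ₐ(v·e) ≡ 0 for one a ⟂ e); frozen constraint ω̄·∇(v·e) ≡ 0. OPEN:
the general (non-symmetric, non-flat) poloidal Type-I Liouville theorem. [difficulty: XL] -/
@[route_item "route-NavierStokesRegularity-FilamentPinchDoor", crux]
def PoloidalWindowRigidity : Prop :=
  ∀ (C : ℝ) (v : ℝ → EuclideanSpace ℝ (Fin 3) → EuclideanSpace ℝ (Fin 3)), Literature.Analysis.FluidPDE.HasTypeITimeDecay C v → ContinuousOn (Function.uncurry v) (Set.Iio (0 : ℝ) ×ˢ Set.univ) → (∀ s t : ℝ, s < t → t < 0 → ∀ x, v t x = Literature.Analysis.UnboundedOperators.heatExtension (v s) (t - s) x - Literature.Analysis.FluidPDE.oseenDuhamel 1 s v v t x) → (∀ t < 0, Literature.Analysis.FluidPDE.VectorCalculus.IsDivFree (v t)) → (∀ s < 0, Continuous (Literature.Analysis.FluidPDE.curl (v s))) ∧ ∀ (e : EuclideanSpace ℝ (Fin 3)), e ≠ 0 → (∀ s < 0, ∃ U : Set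 (EuclideanSpace ℝ (Fin 3)), IsOpen U ∧ U.Nonempty ∧ ∀ y ∈ U, ⟪Literature.Analysis.FluidPDE.curl (v s) y, e⟫_ℝ = 0) → ¬ Literature.Analysis.FluidPDE.IsBackwardSingularPoint v 0

/-- item stmt-NavierStokesRegularity-26432 · support · rank 9 · closed · proved by Summit.NavierStokesRegularity.NavierStokesRegularity.Theorems.filamentPinchDoor_suitableHalfSpaceZoom_proof (prover) · by planner
sources: arXiv:1811.00502, SereginSverak2009, arXiv:0709.3599
[support] Energy-class half-space zoom: under the leaf's frame hypotheses, the door hypothesis and ¬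
backward bounded at (x₀,T), rescaling about x₀ along λ_j→0 yields a profile that is Type-I in time,
continuous, Oseen-mild and divergence-free (the host's HalfSpaceZoom, CLOSED as stmt-25312) AND a
suitable weak solution on the backward slab with a weak spatial gradient and 𝐈 < ∞ (weak-Serrin rate
lemma for u on Q((T,x₀),ρ) + Albritton–Barker/Seregin extraction along the same scales, limits
identified a.e.), backward singular at (0,0), with ⟪curl v(s) y, e⟫ ≥ 0 everywhere. [difficulty: M] -/
@[route_item "route-NavierStokesRegularity-FilamentPinchDoor", crux]
def SuitableHalfSpaceZoom : Prop :=
  ∀ (ν T : ℝ), 0 < ν → 0 < T → ∀ (u : ℝ → EuclideanSpace ℝ (Fin 3) → EuclideanSpace ℝ (Fin 3)) (p : ℝ → EuclideanSpace ℝ (Fin 3) → ℝ), Literature.Analysis.FluidPDE.IsClassicalNSSolutionOn (Set.Ico 0 T) ν 0 u p → Literature.Analysis.FluidPDE.IsLerayHopfOn T ν 0 (u 0) u → Literature.Analysis.FluidPDE.HasRapidSpatialDecay (u 0) → ∀ (x₀ : EuclideanSpace ℝ (Fin 3)) (ρ M : ℝ), 0 < ρ → (∀ t ∈ Set.Ico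 0 T, T - ρ ^ 2 < t → ∀ x ∈ Metric.ball x₀ ρ, ‖u t x‖ * Real.sqrt (ν * (T - t)) ≤ M) → ∀ (e : EuclideanSpace ℝ (Fin 3)), e ≠ 0 → (∀ R : ℝ, 0 < R → Filter.Tendsto (fun t => ∫⁻ y in Metric.ball (0 : EuclideanSpace ℝ (Fin 3)) R, ENNReal.ofReal ((min (⟪(T - t) • Literature.Analysis.FluidPDE.curl (u t) (x₀ + Real.sqrt (T - t) • y), e⟫_ℝ) 0) ^ 2)) (nhdsWithin T (Set.Iio T)) (nhds 0)) → ¬ Literature.Analysis.FluidPDE.IsBackwardBoundedAt u T x₀ → ∃ (C : ℝ) (v : ℝ → EuclideanSpace ℝ (Fin 3) → EuclideanSpace ℝ (Fin 3)) (π : ℝ → EuclideanSpace ℝ (Fin 3) → ℝ) (H : ℝ → EuclideanSpace ℝ (Fin 3) → EuclideanSpace ℝ (Fin 3) →L[ℝ] EuclideanSpace ℝ (Fin 3)), (Literature.Analysis.FluidPDE.HasTypeITimeDecay C v ∧ ContinuousOn (Function.uncurry v) (Set.Iio (0 : ℝ) ×ˢ Set.univ) ∧ (∀ s t : ℝ,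 s < t → t < 0 → ∀ x, v t x = Literature.Analysis.UnboundedOperators.heatExtension (v s) (t - s) x - Literature.Analysis.FluidPDE.oseenDuhamel 1 s v v t x) ∧ (∀ t < 0, Literature.Analysis.FluidPDE.VectorCalculus.IsDivFree (v t))) ∧ (Literature.Analysis.FluidPDE.IsSuitableWeakSolutionOn (Literature.Analysis.FluidPDE.slab (EuclideanSpace ℝ (Fin 3)) (Set.Iio (0 : ℝ)) isOpen_Iio) 1 0 v π ∧ Literature.Analysis.FluidPDE.HasWeakSpatialGradientOn (Literature.Analysis.FluidPDE.slab (EuclideanSpace ℝ (Fin 3)) (Set.Iio (0 : ℝ)) isOpen_Iio) v H ∧ Literature.Analysis.FluidPDE.typeIBound (Set.Iio (0 : ℝ) ×ˢ Set.univ) v π H < ⊤) ∧ Literature.Analysis.FluidPDE.IsBackwardSingularPoint v 0 ∧ ∀ s < 0, ∀ y, 0 ≤ ⟪Literature.Analysis.FluidPDE.curl (v s) y, e⟫_ℝ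

-- `SuitableHalfSpaceZoom` holds: proved by `Summit.NavierStokesRegularity.NavierStokesRegularity.Theorems.filamentPinchDoor_suitableHalfSpaceZoom_proof` (its module imports this route file, so no `_holds` link can be stated here).

/-- item stmt-NavierStokesRegularity-26433 · assembly · rank 1 · closed · proved by Summit.NavierStokesRegularity.NavierStokesRegularity.Theorems.FilamentPinchDoor.Assembly_proof (prover) · by planner
sources: arXiv:1811.00502, arXiv:2501.08976
[assembly] SuitableHalfSpaceZoom → FilamentaryGrowth → FilamentPinchLiouville →
PoloidalWindowRigidity → the half-space window door leaf (HalfSpaceWindowDoor.Target). -/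
@[route_item "route-NavierStokesRegularity-FilamentPinchDoor"]
def Assembly : Prop :=
  SuitableHalfSpaceZoom → FilamentaryGrowth → FilamentPinchLiouville → PoloidalWindowRigidity → Summit.NavierStokesRegularity.NavierStokesRegularity.Theses.HalfSpaceWindowDoor.Target

-- `Assembly` holds: proved by `Summit.NavierStokesRegularity.NavierStokesRegularity.Theorems.FilamentPinchDoor.Assembly_proof` (its module imports this route file, so no `_holds` link can be stated here).

/-! D-0027 §2.1 — DECIDING THEOREM (planner-authored via `route open/edit --closes-file`; by planner-ns-idea-6-g3-0 2026-08-28T07:04:24Z):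
its hypotheses are this route's items and its conclusion the registered leaf `Summit.NavierStokesRegularity.NavierStokesRegularity.Theses.HalfSpaceWindowDoor.Target` (rung N0-LocalTubeDoorHalfSpace (DOOR), D-0061) (glue_lint), and it elaborates with this file. -/

@[closes "route-NavierStokesRegularity-FilamentPinchDoor"] theorem closes (hZ : SuitableHalfSpaceZoom) (hF : FilamentaryGrowth) (hP : FilamentPinchLiouville)
    (hW : PoloidalWindowRigidity) :
    Summit.NavierStokesRegularity.NavierStokesRegularity.Theses.HalfSpaceWindowDoor.Target := by
  intro ν T hν hT u p hcl hLH hdec x₀ ρ M hρ hTI e he hfade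
  by_contra hbb
  obtain ⟨C, v, π, H, ⟨hdecay, hcont, hmild, hdiv⟩, ⟨hsw, hwg, hI⟩, hsing, hnn⟩ :=
    hZ ν T hν hT u p hcl hLH hdec x₀ ρ M hρ hTI e he hfade hbb
  have hK : ∃ K : ℝ, ∀ s < 0, ∀ (x : EuclideanSpace ℝ (Fin 3)) (R : ℝ), 0 < R → ∫⁻ y in Metric.ball x R, ENNReal.ofReal ⟪Literature.Analysis.FluidPDE.curl (v s) y, e⟫_ℝ ≤ ENNReal.ofReal (K * R) :=
    hF C v π H hdecay hcont hmild hdiv hsw hwg hI e he hnn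
  have hzero : ∀ s < 0, ∀ y, ⟪Literature.Analysis.FluidPDE.curl (v s) y, e⟫_ℝ = 0 :=
    hP C v π H hdecay hcont hmild hdiv hsw hwg hI e he hnn hK hsing
  exact (hW C v hdecay hcont hmild hdiv).2 e he
    (fun s hs => ⟨Set.univ, isOpen_univ, Set.univ_nonempty, fun y _ => hzero s hs y⟩) hsing

end Summit.NavierStokesRegularity.NavierStokesRegularity.Theses.FilamentPinchDoor
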